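import Literature.NumberTheory.LFunctions.WeilTwoPrimeOddMarginEBase
import Literature.NumberTheory.LFunctions.WeilTwoPrimeOddMarginEDataP6
import Literature.NumberTheory.LFunctions.WeilTwoPrimeOddMarginEDataDn2
import Literature.NumberTheory.LFunctions.WeilBlockRowsPZ
import HarnessLib

/-!
# Two-prime odd-margin certificate E: dominance of rows 20–24 of `R = S'_odd(κ') − UᵀU` (factored data)

`WeilCert.checkDomRowPZ` with the materialized block `weilCert23EPm`, the factored inverse `weilCert23EDn/weilCert23ELs` and the Bessel block `weilCert23EHp`, by `decide +kernel` row by row; converted to `checkDomRow` by `WeilCert.checkDomRow_of_PZ` in the assembly file. Pure proof file.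
-/

noncomputable section

namespace Literature.NumberTheory.LFunctions

set_option maxHeartbeats 0 in
/-- Kernel check of the dominance of row 20 of `R` (certificate E, factored data). [folklore] -/
theorem checkDomRowPZ1_20_weilCert23E :
    weilCert23EBase.checkDomRowPZ weilCert23EPm weilCert23EDn weilCert23ELs weilCert23EHp weilCert23EKappa' 1 20 = true := by
  decide +kernel

set_option maxHeartbeats 0 in
/-- Kernel check of the dominance of row 21 of `R` (certificate E, factored data). [folklore] -/
theorem checkDomRowPZ1_21_weilCert23E :
    weilCert23EBase.checkDomRowPZ weilCert23EPm weilCert23EDn weilCert23ELs weilCert23EHp weilCert23EKappa' 1 21 = true := by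
  decide +kernel

set_option maxHeartbeats 0 in
/-- Kernel check of the dominance of row 22 of `R` (certificate E, factored data). [folklore] -/
theorem checkDomRowPZ1_22_weilCert23E :
    weilCert23EBase.checkDomRowPZ weilCert23EPm weilCert23EDn weilCert23ELs weilCert23EHp weilCert23EKappa' 1 22 = true := by
  decide +kernel

set_option maxHeartbeats 0 in
/-- Kernel check of the dominance of row 23 of `R` (certificate E, factored data). [folklore] -/
theorem checkDomRowPZ1_23_weilCert23E :
    weilCert23EBase.checkDomRowPZ weilCert23EPm weilCert23EDn weilCert23ELs weilCert23EHp weilCert23EKappa' 1 23 = true := by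
  decide +kernel

set_option maxHeartbeats 0 in
/-- Kernel check of the dominance of row 24 of `R` (certificate E, factored data). [folklore] -/
theorem checkDomRowPZ1_24_weilCert23E :
    weilCert23EBase.checkDomRowPZ weilCert23EPm weilCert23EDn weilCert23ELs weilCert23EHp weilCert23EKappa' 1 24 = true := by
  decide +kernel


end Literature.NumberTheory.LFunctions
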